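import Literature.AnabelianGeometry.SemiGraphs.ArithLevelKerCongruenceTreeLevels
import Literature.AnabelianGeometry.SemiGraphs.FreeGroupsAndActionsProofs2
import Literature.AnabelianGeometry.SemiGraphs.SubdivisionPaths
import Literature.AnabelianGeometry.SemiGraphs.TemperedPiEdgeConjugators
import Literature.AnabelianGeometry.SemiGraphs.TemperedEdgeLikeInfOfHosts
import HarnessLib

/-!
# [SemiAnbd] Lem 1.8 (ii)(b) / Thm 3.7 (ii) at tree levels: vertex-group images are SELF-NORMALISING at
# every level where no vertex group collapses into a branch group — the binder `hself` of the `hK1′`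
# reduction (T54-B, proof-only)

Mochizuki, *Semi-graphs of anabelioids*, Publ. RIMS **42** (2006) 221–322, §1 Lem 1.8 (ii)(b) p. 20 (a finite
group acting on a tree and fixing two vertices fixes every geodesic between them), §3 Thm 3.7 (ii)/(iii)
p. 41 (verticial subgroups are commensurably terminal; the trees `𝒢_{∞,i}`), §5 Prop 5.2 (i)/(iv) pp. 63–64
[cite: MochizukiSemiAnbd2006, Thm 3.7 (iii), p. 41].

PROOF-ONLY file (abc-iut cell, layer L3, sub-DAG `plan/L3/SUBDAG-SemiAnbd-Thm54.md`, producer row T54-B =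
`plan/GAP-LEDGER.md` G-w4d053-1, residual binder «T54·hK1′» → «hCC + hself» (abc-iut-L3-lead α86/11:03Z board
of record); piece (S5) of abc-iut-w6-d117 gen 2).  No definition, no new named fact.

abc-iut-w6-d117's `ArithLevelKerCongruenceTreeLevels` (p439687) reduced the capstone's continuity binder `hK1′`
at the tree levels to congruence-continuity (`hCC`, DESIGN) plus `hself`: «the image of every vertex group `H_w`
in `Γ ⧸ L` is self-normalising».  Here `hself` is PROVED at every tree level `L` at which no vertex group
collapses into a positioned branch group modulo `L` (binder `hElev : ¬ H_w ≤ s_b M_ε s_b⁻¹ ⊔ L`):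

* `SubgroupPresentation.hself_of_isTree_of_not_le` — for a presentation `P` of a GRAPH `𝔾` in `Γ`, a normal
  level `L` with `P.cosetGraph L` a tree and finite vertex images `H_w L / L`: if `ḡ` normalises the image of
  `H_w`, the finite group `H_w L/L` fixes the two vertices `H_w · 1 · L` and `H_w · g⁻¹ · L` of the tree; if they
  differ, Lem 1.8 (ii)(b) (`lemma_1_8_ii_b_holds`, abc-iut-L3-t11) makes it fix the first branch of a geodesic
  between them, i.e. an edge class `M_ε y L` with `H_w s_b y L = H_w L` (abc-iut-w4-d059's
  `deckAct_fixes_eMk_iff`), whence `H_w ≤ s_b M_ε s_b⁻¹ ⊔ L` — excluded by `hElev`; so the two vertices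
  coincide and `ḡ ∈ H_w L / L`.

The sequel file instantiates this at the canonical tower (`hElev` at all deep levels from total elevation +
compactness + cofinality) and removes `hself` from the `hK1′` reduction.  Nothing here refers to the IUT corpus;
no side is taken on [IUTchIII] Cor. 3.12; typed ≠ proved for the residual inputs.
-/

namespace Literature.AnabelianGeometry.SemiGraphs

open CategoryTheory Topology Filter
open Literature.AnabelianGeometry.EtaleTheta
open scoped Pointwise

universe u v w

namespace SemiGraph

namespace SubgroupPresentation

variable {𝔾 : SemiGraph.{u}} {Γ : Type u} [Group Γ] (P : SubgroupPresentation 𝔾 Γ) (L : Subgroup Γ)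

/-- An element of `H_w` fixes the vertex `H_w y L` as soon as `y h y⁻¹ ∈ H_w` modulo `L` — the set form of
abc-iut-w4-d059's `deckAct_fixes_vMk_iff`. [cite: MochizukiSemiAnbd2006, Thm 3.7 (iii), p. 41] -/
theorem deckAct_fixes_vMk_of_exists [L.Normal] {w : 𝔾.Vertex} {h y : Γ}
    (hy : ∃ a ∈ P.H w, ∃ k ∈ L, a * k = y * h * y⁻¹) :
    (P.deckAct L h).hom.vertexMap (P.vMk L w y) = P.vMk L w y := by
  rw [P.deckAct_fixes_vMk_iff]
  obtain ⟨a, ha, k, hk, hak⟩ := hy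
  exact Set.mem_mul.mpr ⟨a, ha, k, hk, hak⟩

/-- If the deck transformation of `h` fixes the branch `(b, M_ε y L)` of the coset semi-graph then
`y h y⁻¹ ∈ M_ε · L`. [cite: MochizukiSemiAnbd2006, Thm 3.7 (iii), p. 41] -/
theorem exists_of_deckAct_fixes_bMk [L.Normal] {b : 𝔾.Branch} {h y : Γ}
    (hfix : (P.deckAct L h).hom.branchMap (P.bMk L b y) = P.bMk L b y) :
    ∃ m ∈ P.M (𝔾.edgeOf b), ∃ l ∈ L, m * l = y * h * y⁻¹ := by
  have hedge : (P.deckAct L h).hom.edgeMap (P.eMk L (𝔾.edgeOf b) y) = P.eMk L (𝔾.edgeOf b) y := by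
    have := congrArg (P.cosetGraph L).edgeOf hfix
    rwa [(P.deckAct L h).hom.edgeOf_branchMap] at this
  rw [P.deckAct_fixes_eMk_iff] at hedge
  exact Set.mem_mul.mp hedge

/-- **Vertex-group images are self-normalising at a tree level where no vertex group collapses into a
branch group** ([SemiAnbd] Thm 3.7 (ii) at the level, via Lem 1.8 (ii)(b)).  For a presentation `P` of a
graph `𝔾` (every branch abuts) in `Γ` and a normal level `L` with `P.cosetGraph L` a TREE, finite vertex
images `H_w L/L`, and `hElev : ¬ H_w ≤ s_b M_{ε} s_b⁻¹ ⊔ L` for every branch `b : ε → w`: every `q ∈ Γ ⧸ L`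
normalising the image of `H_w` lies in it — the binder `hself` of abc-iut-L3-d2's
`isOpen_map_levelKer_of_congruent_lifts_of_simple`. [cite: MochizukiSemiAnbd2006, Thm 3.7 (ii), p. 41] -/
theorem hself_of_isTree_of_not_le [L.Normal] (hT : (P.cosetGraph L).IsTree) (hG : 𝔾.IsGraph)
    (hfin : ∀ w : 𝔾.Vertex, Finite ((P.H w).map (QuotientGroup.mk' L)))
    (hElev : ∀ (b : 𝔾.Branch) (w : 𝔾.Vertex), 𝔾.abuts b = some w →
      ¬ P.H w ≤ (P.M (𝔾.edgeOf b)).map (MulAut.conj (P.s b)).toMonoidHom ⊔ L)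
    (w : 𝔾.Vertex) (q : Γ ⧸ L)
    (hq : ∀ x : Γ ⧸ L, x ∈ (P.H w).map (QuotientGroup.mk' L) ↔
      q⁻¹ * x * q ∈ (P.H w).map (QuotientGroup.mk' L)) :
    q ∈ (P.H w).map (QuotientGroup.mk' L) := by
  obtain ⟨g, rfl⟩ := QuotientGroup.mk'_surjective L q
  set Hbar : Subgroup (Γ ⧸ L) := (P.H w).map (QuotientGroup.mk' L) with hHbar
  -- `g⁻¹ H_w g ⊆ H_w · L`
  have hconj : ∀ h ∈ P.H w, ∃ a ∈ P.H w, ∃ k ∈ L, a * k = g⁻¹ * h * g⁻¹⁻¹ := by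
    intro h hh
    have hx : (QuotientGroup.mk' L g)⁻¹ * QuotientGroup.mk' L h * QuotientGroup.mk' L g ∈ Hbar :=
      (hq _).mp ⟨h, hh, rfl⟩
    obtain ⟨a, ha, hax⟩ := hx
    rw [← map_inv, ← map_mul, ← map_mul, QuotientGroup.mk'_apply, QuotientGroup.mk'_apply,
      QuotientGroup.eq] at hax
    refine ⟨a, ha, a⁻¹ * (g⁻¹ * h * g), hax, ?_⟩
    rw [inv_inv, mul_inv_cancel_left]
  -- the two vertices `H_w 1 L` and `H_w g⁻¹ L`
  by_cases hx : P.vMk L w g⁻¹ = P.vMk L w 1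
  · -- they coincide: `g ∈ H_w · L`
    rw [P.vMk_eq_vMk_iff, DoubleCoset.eq] at hx
    obtain ⟨a, ha, k, hk, hak⟩ := hx
    -- `1 = a * g⁻¹ * k`, so `g = k * a`
    have h1 : a * g⁻¹ = k⁻¹ := mul_eq_one_iff_eq_inv.mp hak.symm
    have h2 : g⁻¹ = a⁻¹ * k⁻¹ := eq_inv_mul_of_mul_eq h1
    have hg : g = k * a := by rw [← inv_inv g, h2, mul_inv_rev, inv_inv, inv_inv]
    refine ⟨a, ha, ?_⟩
    rw [QuotientGroup.mk'_apply, QuotientGroup.mk'_apply, QuotientGroup.eq, hg]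
    simpa [mul_assoc] using Subgroup.Normal.conj_mem' ‹L.Normal› k hk a
  · -- they differ: the finite group `H_w L / L` fixes both, hence a geodesic between them
    exfalso
    haveI := hfin w
    let ρbar : Γ ⧸ L →* Aut (P.cosetGraph L) := QuotientGroup.lift L (P.deckAct L) (P.le_ker_deckAct L)
    let ρ : Hbar →* Aut (P.cosetGraph L) := ρbar.comp Hbar.subtype
    have hρ : ∀ (γ : Hbar), ∃ h ∈ P.H w, ρ γ = P.deckAct L h := by
      rintro ⟨_, h, hh, rfl⟩
      exact ⟨h, hh, QuotientGroup.lift_mk' L (P.le_ker_deckAct L) h⟩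
    have hne : P.vMk L w 1 ≠ P.vMk L w g⁻¹ := fun h => hx h.symm
    have hw₁ : ∀ γ : Hbar, (ρ γ).hom.vertexMap (P.vMk L w 1) = P.vMk L w 1 := by
      intro γ
      obtain ⟨h, hh, hγ⟩ := hρ γ
      rw [hγ]
      exact P.deckAct_fixes_vMk_of_exists L ⟨h, hh, 1, L.one_mem, by group⟩
    have hw₂ : ∀ γ : Hbar, (ρ γ).hom.vertexMap (P.vMk L w g⁻¹) = P.vMk L w g⁻¹ := by
      intro γ
      obtain ⟨h, hh, hγ⟩ := hρ γ
      rw [hγ]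
      exact P.deckAct_fixes_vMk_of_exists L (hconj h hh)
    -- a geodesic from `H_w 1 L` to `H_w g⁻¹ L` in the subdivision of the tree
    obtain ⟨p, hp⟩ := hT.isTree.connected.exists_walk_length_eq_dist
      (Sum.inl (P.vMk L w 1) : (P.cosetGraph L).Node) (Sum.inl (P.vMk L w g⁻¹))
    have h0 : 0 < p.length := by
      rcases Nat.eq_zero_or_pos p.length with h0 | h0
      · exact absurd (Sum.inl.inj (SimpleGraph.Walk.eq_of_length_eq_zero h0)) hne
      · exact h0
    -- its first step is a branch `c` abutting to `H_w 1 L`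
    obtain ⟨c, hc, hx1⟩ := SemiGraph.step_vertex p h0 p.getVert_zero
    have hx1' : p.getVert 1 = Sum.inr (Sum.inr c) := by simpa using hx1
    -- fixed by the whole of `H_w L / L` (Lem 1.8 (ii)(b))
    have hcfix : ∀ γ : Hbar, (ρ γ).hom.branchMap c = c := by
      intro γ
      have h18 := lemma_1_8_ii_b_holds (P.cosetGraph L) Hbar ρ hT _ _ hne hw₁ hw₂ p hp (p.getVert 1)
        (p.getVert_mem_support 1) γ
      rw [hx1'] at h18
      simpa [nodeMap] using h18
    -- read `c = (b, M_ε y L)` with `b : ε → w` downstairs and `H_w s_b y L = H_w 1 L`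
    obtain ⟨b, y, rfl⟩ := P.bMk_surjective L c
    obtain ⟨w', hw'⟩ : ∃ w', 𝔾.abuts b = some w' := Option.isSome_iff_exists.mp (hG.abuts_isSome b)
    have habut := P.cosetGraph_abuts_bMk L b w' hw' y
    rw [hc] at habut
    have hww : w' = w := ((Sigma.mk.inj_iff.mp (Option.some_injective _ habut)).1).symm
    subst hww
    have hcl : DoubleCoset.mk (P.H w') L (P.s b * y) = DoubleCoset.mk (P.H w') L 1 :=
      ((P.vMk_eq_vMk_iff L).mp (Option.some_injective _ habut)).symm
    rw [DoubleCoset.eq] at hcl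
    obtain ⟨a, ha, k, hk, hak⟩ := hcl
    -- `1 = a * (s_b * y) * k`; the representative `y₂ := s_b⁻¹ a⁻¹` gives the same edge class
    have hy : y = (P.s b)⁻¹ * a⁻¹ * k⁻¹ := by
      have : a * (P.s b * y) * k = 1 := hak.symm
      calc y = (P.s b)⁻¹ * a⁻¹ * (a * (P.s b * y) * k) * k⁻¹ := by group
        _ = (P.s b)⁻¹ * a⁻¹ * k⁻¹ := by rw [this]; group
    have hcl2 : DoubleCoset.mk (P.M (𝔾.edgeOf b)) L y =
        DoubleCoset.mk (P.M (𝔾.edgeOf b)) L ((P.s b)⁻¹ * a⁻¹) :=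
      (DoubleCoset.eq _ _ _ _).mpr ⟨1, Subgroup.one_mem _, k, hk, by rw [hy]; group⟩
    have hbMk : P.bMk L b y = P.bMk L b ((P.s b)⁻¹ * a⁻¹) :=
      Subtype.ext <| Prod.ext rfl <| Sigma.ext rfl (heq_of_eq hcl2)
    -- every `h ∈ H_w` lies in `s_b M_ε s_b⁻¹ ⊔ L`
    refine hElev b w' hw' fun h hh => ?_
    -- apply the fixed branch to `a h a⁻¹ ∈ H_w`
    have hh' : a * h * a⁻¹ ∈ P.H w' := Subgroup.mul_mem _ (Subgroup.mul_mem _ ha hh) (Subgroup.inv_mem _ ha)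
    have hfix := hcfix ⟨QuotientGroup.mk' L (a * h * a⁻¹), ⟨_, hh', rfl⟩⟩
    rw [show ρ ⟨QuotientGroup.mk' L (a * h * a⁻¹), ⟨_, hh', rfl⟩⟩ = P.deckAct L (a * h * a⁻¹) from
      QuotientGroup.lift_mk' L (P.le_ker_deckAct L) (a * h * a⁻¹), hbMk] at hfix
    obtain ⟨m, hm, l, hl, hml⟩ := P.exists_of_deckAct_fixes_bMk L hfix
    -- `m * l = (s_b⁻¹ a⁻¹) (a h a⁻¹) (s_b⁻¹ a⁻¹)⁻¹ = s_b⁻¹ h s_b`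
    have hml' : h = (P.s b * m * (P.s b)⁻¹) * (P.s b * l * (P.s b)⁻¹) := by
      have : m * l = (P.s b)⁻¹ * h * P.s b := by rw [hml]; group
      calc h = P.s b * ((P.s b)⁻¹ * h * P.s b) * (P.s b)⁻¹ := by group
        _ = P.s b * (m * l) * (P.s b)⁻¹ := by rw [this]
        _ = (P.s b * m * (P.s b)⁻¹) * (P.s b * l * (P.s b)⁻¹) := by group
    rw [hml']
    refine Subgroup.mul_mem_sup ⟨m, hm, rfl⟩ ?_
    exact Subgroup.Normal.conj_mem inferInstance l hl (P.s b)

end SubgroupPresentation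

end SemiGraph

/-! ### §2 A closed proper subgroup is eventually not dense modulo a cofinal family of levels -/

section Eventually

variable {G : Type u} [Group G] [TopologicalSpace G] [IsTopologicalGroup G]

/-- If `B` is CLOSED and `H ≰ B`, then `H ≰ B ⊔ L n` for all deep levels `n` of an antitone family of normal
subgroups cofinal at `1`: pick `h ∈ H ∖ B`; `h · U ∩ B = ∅` for a neighbourhood `U ∋ 1`; once `L n ⊆ U`,
`h ∉ B · L n`. [cite: MochizukiSemiAnbd2006, Prop 3.6 (i), p. 38] -/
theorem exists_forall_not_le_sup_of_isClosed (H B : Subgroup G) (hB : IsClosed (B : Set G)) (hne : ¬ H ≤ B)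
    (L : ℕ → Subgroup G) (hLn : ∀ n, (L n).Normal) (hanti : Antitone L)
    (hcof : ∀ U ∈ 𝓝 (1 : G), ∃ n, (L n : Set G) ⊆ U) :
    ∃ n₀, ∀ n, n₀ ≤ n → ¬ H ≤ B ⊔ L n := by
  obtain ⟨h, hhH, hhB⟩ := SetLike.not_le_iff_exists.mp hne
  -- a neighbourhood `U` of `1` with `h · U` disjoint from `B`
  set U : Set G := {u | h * u ∈ (B : Set G)ᶜ} with hU
  have hUo : IsOpen U := (continuous_const_mul h).isOpen_preimage _ hB.isOpen_compl
  have h1U : (1 : G) ∈ U := by simpa [hU] using hhB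
  obtain ⟨n₀, hn₀⟩ := hcof U (hUo.mem_nhds h1U)
  refine ⟨n₀, fun n hn hle => ?_⟩
  haveI := hLn n
  have hmem : h ∈ ((B ⊔ L n : Subgroup G) : Set G) := hle hhH
  rw [Subgroup.mul_normal] at hmem
  obtain ⟨m, hm, l, hl, hml⟩ := Set.mem_mul.mp hmem
  have hl' : l⁻¹ ∈ U := hn₀ (hanti hn ((L n).inv_mem hl))
  have : h * l⁻¹ = m := by rw [← hml, mul_inv_cancel_right]
  exact hl' (by rw [this]; exact hm)

end Eventually

/-! ### §3 At the canonical tower: `hself` at all deep tree levels, and `hK1′ ⟸ hCC` alone -/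

namespace ProfiniteSemiGraph

variable {𝒢 : ProfiniteSemiGraph.{u}}

/-- **The vertex images `H_w · ker ρ_n / ker ρ_n` are FINITE** (`H_w` compact, `ker ρ_n` open).
[cite: MochizukiSemiAnbd2006, Prop 3.6 (i), p. 38] -/
theorem GaloisLevelData.finite_map_mk_piPresentation_H (D : GaloisLevelData 𝒢) (h𝒢 : 𝒢.IsCountable)
    (T : ∀ w : 𝒢.graph.Vertex, D.PointSeq h𝒢 w) (R : SemiGraph.RefBranches 𝒢.graph) (n : ℕ)
    (w : 𝒢.graph.Vertex) :
    Finite (((D.piPresentation h𝒢 T R).H w).map (QuotientGroup.mk' (D.projAut h𝒢 n).ker)) := by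
  haveI := QuotientGroup.discreteTopology (D.isOpen_ker_projAut h𝒢 n)
  have hc : IsCompact ((((D.piPresentation h𝒢 T R).H w).map (QuotientGroup.mk' (D.projAut h𝒢 n).ker) :
      Subgroup (D.temperedPi h𝒢 ⧸ (D.projAut h𝒢 n).ker)) : Set (D.temperedPi h𝒢 ⧸ (D.projAut h𝒢 n).ker)) := by
    rw [Subgroup.coe_map]
    exact (D.isCompact_piPresentation_H h𝒢 T R w).image QuotientGroup.continuous_mk
  exact hc.finite_of_discrete.to_subtype

/-- **No vertex group collapses into a branch group modulo the DEEP tree levels** (`hElev` of §1 at the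
canonical tower): for every branch `b : ε → w`, `H_w ≰ s_b M_ε s_b⁻¹ ⊔ ker ρ_n` for all `n ≥ n₀(b)` — from
TOTAL ELEVATION (`Π_b ≠ Π_w`, abc-iut-w5-d197/w4-d075's `branchSubgroup_ne_top`), injectivity of the decomposition
homomorphisms (Thm 3.7 (i), `verticialInjective_holds`), abc-iut-w4-d053's `s_b M_ε s_b⁻¹ = D(Π_b)`, compactness
of `Π_b` and cofinality of the tree levels. [cite: MochizukiSemiAnbd2006, Thm 3.7 (i), p. 40] -/
theorem exists_forall_not_H_le_conj_M_sup_ker (h37 : 𝒢.Thm37Hypotheses)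
    (T : ∀ w : 𝒢.graph.Vertex,
      (𝒢.galoisLevelData h37.toProp36Hypotheses).PointSeq h37.toProp36Hypotheses.isCountable w)
    (R : SemiGraph.RefBranches 𝒢.graph) (b : 𝒢.graph.Branch) (w : 𝒢.graph.Vertex)
    (hw : 𝒢.graph.abuts b = some w) :
    ∃ n₀, ∀ n, n₀ ≤ n →
      ¬ ((𝒢.galoisLevelData h37.toProp36Hypotheses).piPresentation h37.toProp36Hypotheses.isCountable T R).H w ≤
        (((𝒢.galoisLevelData h37.toProp36Hypotheses).piPresentation h37.toProp36Hypotheses.isCountable T R).M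
            (𝒢.graph.edgeOf b)).map
          (MulAut.conj (((𝒢.galoisLevelData h37.toProp36Hypotheses).piPresentation
            h37.toProp36Hypotheses.isCountable T R).s b)).toMonoidHom ⊔
        ((𝒢.galoisLevelData h37.toProp36Hypotheses).projAut h37.toProp36Hypotheses.isCountable n).ker := by
  haveI := (𝒢.galoisLevelData h37.toProp36Hypotheses).t2Space_temperedPi h37.toProp36Hypotheses.isCountable
  -- injectivity of the decomposition homomorphism at `w` (Thm 3.7 (i))
  have hinj : Function.Injective (T w).decompHom :=
    ((verticialInjective_holds 𝒢 h37 (𝒢.temperedPiChart h37.toProp36Hypotheses) w).2 (T w).decompHomCont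
      (T w).isVerticialHom_decompHomCont :)
  -- the positioned branch group is `D(Π_b)`, the vertex group is `D(Π_w)`
  have hB := (𝒢.galoisLevelData h37.toProp36Hypotheses).map_conj_s_piPresentation_M
    h37.toProp36Hypotheses.isCountable T R b w hw
  have hH : ((𝒢.galoisLevelData h37.toProp36Hypotheses).piPresentation h37.toProp36Hypotheses.isCountable
      T R).H w = (⊤ : Subgroup (𝒢.Gv w)).map (T w).decompHom := by
    rw [(𝒢.galoisLevelData h37.toProp36Hypotheses).piPresentation_H h37.toProp36Hypotheses.isCountable T R,
      MonoidHom.range_eq_map]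
  refine exists_forall_not_le_sup_of_isClosed _ _ ?_ ?_
    (fun n => ((𝒢.galoisLevelData h37.toProp36Hypotheses).projAut h37.toProp36Hypotheses.isCountable n).ker)
    (fun _ => MonoidHom.normal_ker _)
    ((𝒢.galoisLevelData h37.toProp36Hypotheses).ker_projAut_anti h37.toProp36Hypotheses.isCountable)
    (fun _ hU => (𝒢.galoisLevelData h37.toProp36Hypotheses).exists_ker_projAut_subset
      h37.toProp36Hypotheses.isCountable hU)
  · -- closed: continuous image of the compact `Π_b`
    rw [hB, Subgroup.coe_map]
    refine (IsCompact.image ?_ (T w).continuous_decompHom).isClosed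
    unfold ProfiniteSemiGraph.branchSubgroup
    rw [MonoidHom.coe_range]
    exact isCompact_range (map_continuous (𝒢.brHom b w hw))
  · -- proper: `Π_b ≠ Π_w` (total elevation) and `D` injective
    rw [hB, hH, Subgroup.map_le_map_iff_of_injective hinj, top_le_iff]
    exact branchSubgroup_ne_top h37.isTotallyElevated hw

/-- **`hself` holds at ALL DEEP tree levels of the canonical tower** (for a FINITE graph `𝔾`): there is `n₀`
such that for every `n ≥ n₀` and every vertex `w`, the image of `H_w` in `π₁^temp(𝒢) ⧸ ker ρ_n =
Gal(𝒢_{∞,n}/𝒢)` is self-normalising — [SemiAnbd] Thm 3.7 (ii) read at the deep finite stages of the tower.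
[cite: MochizukiSemiAnbd2006, Thm 3.7 (ii), p. 41] -/
theorem exists_forall_piPresentation_hself (h37 : 𝒢.Thm37Hypotheses) (hG : 𝒢.graph.IsGraph)
    [Finite 𝒢.graph.Branch]
    (T : ∀ w : 𝒢.graph.Vertex,
      (𝒢.galoisLevelData h37.toProp36Hypotheses).PointSeq h37.toProp36Hypotheses.isCountable w)
    (R : SemiGraph.RefBranches 𝒢.graph) :
    ∃ n₀, ∀ n, n₀ ≤ n → ∀ (w : 𝒢.graph.Vertex)
      (q : (𝒢.galoisLevelData h37.toProp36Hypotheses).temperedPi h37.toProp36Hypotheses.isCountable ⧸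
        ((𝒢.galoisLevelData h37.toProp36Hypotheses).projAut h37.toProp36Hypotheses.isCountable n).ker),
      (∀ x : (𝒢.galoisLevelData h37.toProp36Hypotheses).temperedPi h37.toProp36Hypotheses.isCountable ⧸
          ((𝒢.galoisLevelData h37.toProp36Hypotheses).projAut h37.toProp36Hypotheses.isCountable n).ker,
        x ∈ (((𝒢.galoisLevelData h37.toProp36Hypotheses).piPresentation h37.toProp36Hypotheses.isCountable
          T R).H w).map (QuotientGroup.mk' _) ↔
        q⁻¹ * x * q ∈ (((𝒢.galoisLevelData h37.toProp36Hypotheses).piPresentation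
          h37.toProp36Hypotheses.isCountable T R).H w).map (QuotientGroup.mk' _)) →
      q ∈ (((𝒢.galoisLevelData h37.toProp36Hypotheses).piPresentation h37.toProp36Hypotheses.isCountable
        T R).H w).map (QuotientGroup.mk' _) := by
  -- one threshold per branch (at its vertex), then the maximum over the finitely many branches
  have hb : ∀ b : 𝒢.graph.Branch, ∃ n₀, ∀ n, n₀ ≤ n → ∀ (w : 𝒢.graph.Vertex), 𝒢.graph.abuts b = some w →
      ¬ ((𝒢.galoisLevelData h37.toProp36Hypotheses).piPresentation h37.toProp36Hypotheses.isCountable T R).H w ≤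
        (((𝒢.galoisLevelData h37.toProp36Hypotheses).piPresentation h37.toProp36Hypotheses.isCountable T R).M
            (𝒢.graph.edgeOf b)).map
          (MulAut.conj (((𝒢.galoisLevelData h37.toProp36Hypotheses).piPresentation
            h37.toProp36Hypotheses.isCountable T R).s b)).toMonoidHom ⊔
        ((𝒢.galoisLevelData h37.toProp36Hypotheses).projAut h37.toProp36Hypotheses.isCountable n).ker := by
    intro b
    obtain ⟨w, hw⟩ := Option.isSome_iff_exists.mp (hG.abuts_isSome b)
    obtain ⟨n₀, hn₀⟩ := exists_forall_not_H_le_conj_M_sup_ker h37 T R b w hw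
    refine ⟨n₀, fun n hn w' hw' => ?_⟩
    obtain rfl : w' = w := Option.some_injective _ (hw'.symm.trans hw)
    exact hn₀ n hn
  choose n₀ hn₀ using hb
  obtain ⟨N, hN⟩ := (Set.finite_range n₀).bddAbove
  refine ⟨N, fun n hn w q hq => ?_⟩
  haveI : (((𝒢.galoisLevelData h37.toProp36Hypotheses).projAut h37.toProp36Hypotheses.isCountable n).ker).Normal :=
    MonoidHom.normal_ker _
  exact ((𝒢.galoisLevelData h37.toProp36Hypotheses).piPresentation h37.toProp36Hypotheses.isCountable
      T R).hself_of_isTree_of_not_le _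
    ((𝒢.galoisLevelData h37.toProp36Hypotheses).piPresentation_hT h37.toProp36Hypotheses.isCountable T R n) hG
    ((𝒢.galoisLevelData h37.toProp36Hypotheses).finite_map_mk_piPresentation_H
      h37.toProp36Hypotheses.isCountable T R n)
    (fun b w' hw' => hn₀ b n ((hN ⟨b, rfl⟩).trans hn) w' hw') w q hq

/-- **The capstone binder `hK1′` (all tree levels of the canonical tower) ⟸ congruence-continuity of `ρ'`
at all DEEP tree levels ALONE** (for a finite graph `𝔾` satisfying Thm 3.7's hypotheses): abc-iut-w6-d117's
`hK1'_of_eventually_congruenceContinuous_of_hself` with `hself` DISCHARGED by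
`exists_forall_piPresentation_hself`.  The residual `hCC` is print's Def 5.1 (i)(c)/(d) read at the tree
levels through Prop 5.2 (i) — a DESIGN input on the outer action `ρ'` (finite monodromy: abc-iut-w6-d117's
`hK1'_of_isOpen_ker`). [cite: MochizukiSemiAnbd2006, Prop 5.2 (iv), p. 64] -/
theorem hK1'_of_eventually_congruenceContinuous (h37 : 𝒢.Thm37Hypotheses) (hG : 𝒢.graph.IsGraph)
    [Finite 𝒢.graph.Branch]
    {PA : Type w} [Group PA] [TopologicalSpace PA] [ContinuousMul PA]
    (ρ' : PA →* TopOut (𝒢.temperedPiChart h37.toProp36Hypotheses).G) (baseAct : PA →* Aut 𝒢.graph)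
    (T : ∀ w : 𝒢.graph.Vertex,
      (𝒢.galoisLevelData h37.toProp36Hypotheses).PointSeq h37.toProp36Hypotheses.isCountable w)
    (R : SemiGraph.RefBranches 𝒢.graph)
    (hP : ((𝒢.galoisLevelData h37.toProp36Hypotheses).piPresentation h37.toProp36Hypotheses.isCountable
      T R).IsArithCompatible
      (((contMulAut (𝒢.temperedPiChart h37.toProp36Hypotheses).G).subtype.comp
        (MonoidHom.fst (contMulAut (𝒢.temperedPiChart h37.toProp36Hypotheses).G) PA)).comp
          (outerSemidirectProduct ρ').subtype)
      (baseAct.comp (outerSemidirectProductSnd ρ')))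
    (hLst : ∀ (n : ℕ) (e : outerSemidirectProduct ρ') (x : (𝒢.temperedPiChart h37.toProp36Hypotheses).G),
      x ∈ ((𝒢.galoisLevelData h37.toProp36Hypotheses).piLevelAut h37.toProp36Hypotheses.isCountable
        (𝒢.galoisLevelData_hconn h37.toProp36Hypotheses) n).ker →
        (((contMulAut (𝒢.temperedPiChart h37.toProp36Hypotheses).G).subtype.comp
          (MonoidHom.fst (contMulAut (𝒢.temperedPiChart h37.toProp36Hypotheses).G) PA)).comp
            (outerSemidirectProduct ρ').subtype) e x ∈
          ((𝒢.galoisLevelData h37.toProp36Hypotheses).piLevelAut h37.toProp36Hypotheses.isCountable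
            (𝒢.galoisLevelData_hconn h37.toProp36Hypotheses) n).ker)
    (n₁ : ℕ)
    (hCC : ∀ n, n₁ ≤ n → ∃ U ∈ 𝓝 (1 : PA), ∀ a ∈ U, baseAct a = 1 ∧
      ∃ φ : contMulAut (𝒢.temperedPiChart h37.toProp36Hypotheses).G,
        TopOut.mk (𝒢.temperedPiChart h37.toProp36Hypotheses).G φ = ρ' a ∧
        ∀ y : (𝒢.temperedPiChart h37.toProp36Hypotheses).G,
          (φ : MulAut (𝒢.temperedPiChart h37.toProp36Hypotheses).G) y * y⁻¹ ∈
          ((𝒢.galoisLevelData h37.toProp36Hypotheses).projAut h37.toProp36Hypotheses.isCountable n).ker) :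
    ∀ n, IsOpen (((((𝒢.galoisLevelData h37.toProp36Hypotheses).piPresentation
        h37.toProp36Hypotheses.isCountable T R).levelKer hP
        ((𝒢.galoisLevelData h37.toProp36Hypotheses).projAut h37.toProp36Hypotheses.isCountable n).ker
        ((𝒢.galoisLevelData h37.toProp36Hypotheses).hKst_of_hLst_outerAction h37.toProp36Hypotheses.isCountable
          (𝒢.galoisLevelData_hconn h37.toProp36Hypotheses) T R ρ' hP hLst n)).map
            (outerSemidirectProductSnd ρ') : Subgroup PA) : Set PA) := by
  obtain ⟨n₀, hn₀⟩ := exists_forall_piPresentation_hself h37 hG T R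
  exact hK1'_of_eventually_congruenceContinuous_of_hself h37.toProp36Hypotheses hG ρ' baseAct T R hP hLst
    (max n₀ n₁) (fun n hn => hn₀ n ((le_max_left _ _).trans hn)) (fun n hn => hCC n ((le_max_right _ _).trans hn))

end ProfiniteSemiGraph

end Literature.AnabelianGeometry.SemiGraphs
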